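import Mathlib.Analysis.PSeries
import Mathlib.Analysis.SpecialFunctions.Pow.Real
import Literature.NumberTheory.LFunctions.ZetaZerosJensen
import Literature.NumberTheory.LFunctions.ZetaZerosReflection
import Literature.NumberTheory.LFunctions.WeilZeroSum
import HarnessLib

/-!
# Stub `stub_zeroWindowCount` of the line `Sketch` (crux `WeilGroundState.GroundStatesConvergeToXi`,
item stmt-RiemannHypothesis-1527, rev L9)

**Non-trivial zeros of `ζ` in unit windows, with multiplicity (RH-free).**
1. There is `C > 0` such that for every real `τ` and every finite set `F` of non-trivial zeros
   (`0 < Re ρ < 1`) with `|Im ρ − τ| ≤ 1/2`, `∑_{ρ ∈ F} m(ρ) ≤ C log(|τ| + 2)`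
   (`m = riemannZetaZeroOrder`).  The tree's `exists_sum_zetaZeroWindow_le` (Jensen,
   Montgomery–Vaughan Thm. 10.13) gives this for the zeros with `Re ρ ≥ 1/4`; the zeros with
   `Re ρ < 1/4` are sent injectively into that window by the reflection `ρ ↦ 1 − ρ̄`, which keeps
   the ordinate and the multiplicity (`riemannZetaZeroOrder_one_sub_conj`).
2. For every `s : ℂ`, `∑_ρ m(ρ) log(|Im ρ| + 2)/‖s − ρ‖² < ∞` over all non-trivial zeros:
   by partial summation over the unit windows `j = |round(Im ρ)|` (`windowIndex`) and part 1,
   `∑_ρ m(ρ) log(|γ|+2)/(|γ|+2)²` is dominated by `8C ∑_j log²(j+3)/(j+3)²`, and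
   `∑ log² n / n² < ∞` (compare with `n^{-3/2}` via `log n ≤ 4 n^{1/4}`); finally
   `‖s − ρ‖ ≥ (|γ| + 2)/4` for all but the finitely many zeros in the disc `‖ρ‖ < 2‖s‖ + 2`.
-/

set_option linter.dupNamespace false

noncomputable section

open MeasureTheory Complex Filter Set
open scoped Real Topology ComplexConjugate

namespace Summit.RiemannHypothesis.RiemannHypothesis.Theorems.GroundStatesConvergeToXi

open Literature.NumberTheory.LFunctions

/-- **Part 1: all non-trivial zeros of a unit window, with multiplicity, are `≪ log(|τ|+2)`.**
There is `C > 0` with `∑_{ρ ∈ F} m(ρ) ≤ C log(|τ| + 2)` for every finite set `F` of non-trivial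
zeros with `|Im ρ − τ| ≤ 1/2` (Jensen for `Re ρ ≥ 1/4`, `exists_sum_zetaZeroWindow_le`; reflection
`ρ ↦ 1 − ρ̄` for `Re ρ < 1/4`). [cite: MontgomeryVaughan2007, Thm. 10.13] -/
theorem zeroWindowCount_exists_sum_le :
    ∃ C : ℝ, 0 < C ∧ ∀ (τ : ℝ) (F : Finset ℂ),
      (∀ ρ ∈ F, ρ ∈ ZetaZeros.riemannZetaNontrivialZeros ∧ |ρ.im - τ| ≤ 1 / 2) →
        ∑ ρ ∈ F, (riemannZetaZeroOrder ρ : ℝ) ≤ C * Real.log (|τ| + 2) := by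
  obtain ⟨C, hC0, hC⟩ := exists_sum_zetaZeroWindow_le
  refine ⟨2 * C, by positivity, fun τ F hF ↦ ?_⟩
  classical
  rw [← Finset.sum_filter_add_sum_filter_not F (fun ρ : ℂ ↦ 1 / 4 ≤ ρ.re)]
  -- zeros with `Re ρ ≥ 1/4`: inclusion into the window
  have h1 : ∑ ρ ∈ F.filter (fun ρ : ℂ ↦ 1 / 4 ≤ ρ.re), (riemannZetaZeroOrder ρ : ℝ) ≤
      C * Real.log (|τ| + 2) := by
    refine le_trans (Finset.sum_le_sum_of_subset_of_nonneg (fun ρ hρ ↦ ?_) fun ρ hρ _ ↦ ?_) (hC τ)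
    · rw [Finset.mem_filter] at hρ
      rw [Set.Finite.mem_toFinset]
      exact ⟨ZetaZeros.riemannZetaNontrivialZeros.zeta_eq_zero (hF ρ hρ.1).1, hρ.2, (hF ρ hρ.1).2⟩
    · rw [Set.Finite.mem_toFinset] at hρ
      exact riemannZetaZeroOrder_nonneg_of_zero hρ.1
  -- zeros with `Re ρ < 1/4`: reflection `ρ ↦ 1 - conj ρ` into the window
  have h2 : ∑ ρ ∈ F.filter (fun ρ : ℂ ↦ ¬ 1 / 4 ≤ ρ.re), (riemannZetaZeroOrder ρ : ℝ) ≤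
      C * Real.log (|τ| + 2) := by
    have hinj : Set.InjOn (fun ρ : ℂ ↦ 1 - conj ρ) (F.filter (fun ρ : ℂ ↦ ¬ 1 / 4 ≤ ρ.re)) := by
      intro a _ b _ hab
      have h := congrArg conj (sub_right_injective hab)
      simpa using h
    have heq : ∑ ρ ∈ F.filter (fun ρ : ℂ ↦ ¬ 1 / 4 ≤ ρ.re), (riemannZetaZeroOrder ρ : ℝ) =
        ∑ ρ ∈ (F.filter (fun ρ : ℂ ↦ ¬ 1 / 4 ≤ ρ.re)).image (fun ρ : ℂ ↦ 1 - conj ρ),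
          (riemannZetaZeroOrder ρ : ℝ) := by
      rw [Finset.sum_image hinj]
      refine Finset.sum_congr rfl fun ρ hρ ↦ ?_
      have h := (hF ρ (Finset.mem_filter.1 hρ).1).1
      rw [riemannZetaZeroOrder_one_sub_conj (ZetaZeros.riemannZetaNontrivialZeros.re_pos h)
        (ZetaZeros.riemannZetaNontrivialZeros.re_lt_one h)]
    rw [heq]
    refine le_trans (Finset.sum_le_sum_of_subset_of_nonneg (fun z hz ↦ ?_) fun ρ hρ _ ↦ ?_) (hC τ)
    · rw [Finset.mem_image] at hz
      obtain ⟨ρ, hρ, rfl⟩ := hz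
      rw [Finset.mem_filter] at hρ
      obtain ⟨h, hτ⟩ := hF ρ hρ.1
      rw [Set.Finite.mem_toFinset]
      refine ⟨ZetaZeros.riemannZetaNontrivialZeros.zeta_eq_zero
        (ZetaZeros.riemannZetaNontrivialZeros.one_sub_conj_mem h), ?_, ?_⟩
      · simp only [sub_re, one_re, conj_re]
        linarith [hρ.2]
      · simpa using hτ
    · rw [Set.Finite.mem_toFinset] at hρ
      exact riemannZetaZeroOrder_nonneg_of_zero hρ.1
  linarith

/-- `log² x ≤ 16 √x` for `x ≥ 1` (`log x ≤ 4 x^{1/4}`, `Real.log_le_rpow_div`). [folklore] -/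
theorem zeroWindowCount_log_sq_le {x : ℝ} (hx : 1 ≤ x) :
    Real.log x ^ 2 ≤ 16 * x ^ (1 / 2 : ℝ) := by
  have hx0 : 0 ≤ x := by linarith
  have h := Real.log_le_rpow_div hx0 (by norm_num : (0 : ℝ) < 1 / 4)
  have h4 : Real.log x ≤ 4 * x ^ (1 / 4 : ℝ) := by
    have : x ^ (1 / 4 : ℝ) / (1 / 4) = 4 * x ^ (1 / 4 : ℝ) := by ring
    linarith
  have hl : 0 ≤ Real.log x := Real.log_nonneg hx
  calc Real.log x ^ 2 ≤ (4 * x ^ (1 / 4 : ℝ)) ^ 2 := pow_le_pow_left₀ hl h4 2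
    _ = 16 * (x ^ (1 / 4 : ℝ)) ^ 2 := by ring
    _ = 16 * x ^ (1 / 2 : ℝ) := by
        rw [← Real.rpow_two, ← Real.rpow_mul hx0]
        norm_num

/-- `∑_n log² n / n² < ∞` (comparison with `∑ n^{-3/2}`). [folklore] -/
theorem zeroWindowCount_summable_log_sq_div_sq :
    Summable fun n : ℕ ↦ Real.log (n : ℝ) ^ 2 / (n : ℝ) ^ 2 := by
  have hs : Summable fun n : ℕ ↦ ((n : ℝ) ^ (3 / 2 : ℝ))⁻¹ :=
    Real.summable_nat_rpow_inv.2 (by norm_num)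
  refine Summable.of_nonneg_of_le (fun n ↦ div_nonneg (sq_nonneg _) (sq_nonneg _)) (fun n ↦ ?_)
    (hs.mul_left 16)
  rcases Nat.eq_zero_or_pos n with hn | hn
  · subst hn
    norm_num
  · have hx : (1 : ℝ) ≤ n := by exact_mod_cast hn
    have hx0 : (0 : ℝ) < n := by positivity
    rw [div_le_iff₀ (by positivity)]
    calc Real.log (n : ℝ) ^ 2 ≤ 16 * (n : ℝ) ^ (1 / 2 : ℝ) := zeroWindowCount_log_sq_le hx
      _ = 16 * ((n : ℝ) ^ (3 / 2 : ℝ))⁻¹ * (n : ℝ) ^ 2 := by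
          rw [mul_assoc]
          congr 1
          rw [eq_inv_mul_iff_mul_eq₀ (by positivity), ← Real.rpow_two, ← Real.rpow_add hx0]
          norm_num

/-- **Part 2, base weight: `∑_ρ m(ρ) log(|γ|+2)/(|γ|+2)² < ∞`** over the non-trivial zeros
(`γ = Im ρ`), by partial summation over the unit windows `j = |round γ|` with part 1:
the window of index `j` contributes `≤ 8 C log²(j+3)/(j+3)²`. [cite: MontgomeryVaughan2007, Thm. 10.13] -/
theorem zeroWindowCount_summable_base :
    Summable fun ρ : ZetaZeros.riemannZetaNontrivialZeros ↦
      (riemannZetaZeroOrder (ρ : ℂ) : ℝ) * Real.log (|(ρ : ℂ).im| + 2) / (|(ρ : ℂ).im| + 2) ^ 2 := by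
  obtain ⟨C, hC0, hC⟩ := zeroWindowCount_exists_sum_le
  have hT : Summable fun j : ℕ ↦ Real.log ((j : ℝ) + 3) ^ 2 / ((j : ℝ) + 3) ^ 2 := by
    have h := (summable_nat_add_iff 3).2 zeroWindowCount_summable_log_sq_div_sq
    simpa [Nat.cast_add] using h
  set T : ℝ := ∑' j : ℕ, Real.log ((j : ℝ) + 3) ^ 2 / ((j : ℝ) + 3) ^ 2 with hTdef
  have hnn : ∀ ρ : ZetaZeros.riemannZetaNontrivialZeros,
      0 ≤ (riemannZetaZeroOrder (ρ : ℂ) : ℝ) * Real.log (|(ρ : ℂ).im| + 2) / (|(ρ : ℂ).im| + 2) ^ 2 :=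
    fun ρ ↦ div_nonneg (mul_nonneg
      (riemannZetaZeroOrder_nonneg_of_zero (ZetaZeros.riemannZetaNontrivialZeros.zeta_eq_zero ρ.2))
      (Real.log_nonneg (by linarith [abs_nonneg (ρ : ℂ).im]))) (sq_nonneg _)
  refine summable_of_sum_le (c := 8 * C * T) hnn fun u ↦ ?_
  classical
  set F := u.map (Function.Embedding.subtype (· ∈ ZetaZeros.riemannZetaNontrivialZeros)) with hF
  have hsum : ∑ x ∈ u, (riemannZetaZeroOrder (x : ℂ) : ℝ) * Real.log (|(x : ℂ).im| + 2) /
        (|(x : ℂ).im| + 2) ^ 2 =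
      ∑ ρ ∈ F, (riemannZetaZeroOrder ρ : ℝ) * Real.log (|ρ.im| + 2) / (|ρ.im| + 2) ^ 2 := by
    rw [hF, Finset.sum_map]
    rfl
  rw [hsum]
  have hFmem : ∀ ρ ∈ F, ρ ∈ ZetaZeros.riemannZetaNontrivialZeros := by
    intro ρ hρ
    rw [hF, Finset.mem_map] at hρ
    obtain ⟨x, -, rfl⟩ := hρ
    exact x.2
  -- group the zeros by window index
  set M : ℕ := F.sup windowIndex + 1 with hM
  have hmaps : ∀ ρ ∈ F, windowIndex ρ ∈ Finset.range M := fun ρ hρ ↦ by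
    rw [Finset.mem_range, hM]
    exact Nat.lt_succ_of_le (Finset.le_sup hρ)
  rw [← Finset.sum_fiberwise_of_maps_to hmaps]
  have hfiber : ∀ j ∈ Finset.range M,
      ∑ ρ ∈ F with windowIndex ρ = j,
          (riemannZetaZeroOrder ρ : ℝ) * Real.log (|ρ.im| + 2) / (|ρ.im| + 2) ^ 2 ≤
        8 * C * (Real.log ((j : ℝ) + 3) ^ 2 / ((j : ℝ) + 3) ^ 2) := by
    intro j _
    have hj0 : (0 : ℝ) ≤ j := j.cast_nonneg
    have hlj : 0 ≤ Real.log ((j : ℝ) + 3) := Real.log_nonneg (by linarith)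
    -- the weight on the window of index `j`
    have hw : ∀ ρ ∈ F.filter (fun ρ ↦ windowIndex ρ = j),
        Real.log (|ρ.im| + 2) / (|ρ.im| + 2) ^ 2 ≤
          4 * Real.log ((j : ℝ) + 3) / ((j : ℝ) + 3) ^ 2 := by
      intro ρ hρ
      rw [Finset.mem_filter] at hρ
      have h1 := windowIndex_le ρ
      have h2 := le_windowIndex ρ
      rw [hρ.2] at h1 h2
      have hγ0 : 0 ≤ |ρ.im| := abs_nonneg _
      have hlog : Real.log (|ρ.im| + 2) ≤ Real.log ((j : ℝ) + 3) :=
        Real.log_le_log (by linarith) (by linarith)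
      have hden : ((j : ℝ) + 3) ^ 2 ≤ 4 * (|ρ.im| + 2) ^ 2 := by nlinarith
      rw [div_le_div_iff₀ (by positivity) (by positivity)]
      calc Real.log (|ρ.im| + 2) * ((j : ℝ) + 3) ^ 2
          ≤ Real.log ((j : ℝ) + 3) * (4 * (|ρ.im| + 2) ^ 2) :=
            mul_le_mul hlog hden (by positivity) hlj
        _ = 4 * Real.log ((j : ℝ) + 3) * (|ρ.im| + 2) ^ 2 := by ring
    -- the count on the window of index `j` (two unit windows, at heights `± j`)
    have hAmem : ∀ ρ ∈ (F.filter (fun ρ ↦ windowIndex ρ = j)).filter (fun ρ : ℂ ↦ 0 ≤ round ρ.im),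
        ρ ∈ ZetaZeros.riemannZetaNontrivialZeros ∧ |ρ.im - (j : ℝ)| ≤ 1 / 2 := by
      intro ρ hρ
      simp only [Finset.mem_filter] at hρ
      obtain ⟨⟨hρF, hj⟩, hr⟩ := hρ
      refine ⟨hFmem ρ hρF, ?_⟩
      have e : ((j : ℕ) : ℝ) = (round ρ.im : ℝ) := by
        rw [← hj, windowIndex, Nat.cast_natAbs, Int.cast_abs, abs_of_nonneg (by exact_mod_cast hr)]
      rw [e]
      exact abs_sub_round ρ.im
    have hBmem : ∀ ρ ∈ (F.filter (fun ρ ↦ windowIndex ρ = j)).filter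
        (fun ρ : ℂ ↦ ¬ 0 ≤ round ρ.im),
        ρ ∈ ZetaZeros.riemannZetaNontrivialZeros ∧ |ρ.im - (-(j : ℝ))| ≤ 1 / 2 := by
      intro ρ hρ
      simp only [Finset.mem_filter, not_le] at hρ
      obtain ⟨⟨hρF, hj⟩, hr⟩ := hρ
      refine ⟨hFmem ρ hρF, ?_⟩
      have e : ((j : ℕ) : ℝ) = -(round ρ.im : ℝ) := by
        rw [← hj, windowIndex, Nat.cast_natAbs, Int.cast_abs, abs_of_neg (by exact_mod_cast hr)]
      rw [e, neg_neg]
      exact abs_sub_round ρ.im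
    have hcount : ∑ ρ ∈ F with windowIndex ρ = j, (riemannZetaZeroOrder ρ : ℝ) ≤
        2 * C * Real.log ((j : ℝ) + 3) := by
      have hA := hC _ _ hAmem
      have hB := hC _ _ hBmem
      rw [Nat.abs_cast] at hA
      rw [abs_neg, Nat.abs_cast] at hB
      have hlog23 : Real.log ((j : ℝ) + 2) ≤ Real.log ((j : ℝ) + 3) :=
        Real.log_le_log (by linarith) (by linarith)
      rw [← Finset.sum_filter_add_sum_filter_not _ (fun ρ : ℂ ↦ 0 ≤ round ρ.im)]
      nlinarith
    calc ∑ ρ ∈ F with windowIndex ρ = j,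
          (riemannZetaZeroOrder ρ : ℝ) * Real.log (|ρ.im| + 2) / (|ρ.im| + 2) ^ 2
        ≤ ∑ ρ ∈ F with windowIndex ρ = j,
            (riemannZetaZeroOrder ρ : ℝ) * (4 * Real.log ((j : ℝ) + 3) / ((j : ℝ) + 3) ^ 2) := by
          refine Finset.sum_le_sum fun ρ hρ ↦ ?_
          have hm : (0 : ℝ) ≤ riemannZetaZeroOrder ρ :=
            riemannZetaZeroOrder_nonneg_of_zero (ZetaZeros.riemannZetaNontrivialZeros.zeta_eq_zero
              (hFmem ρ (Finset.mem_filter.1 hρ).1))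
          rw [mul_div_assoc]
          exact mul_le_mul_of_nonneg_left (hw ρ hρ) hm
      _ = (4 * Real.log ((j : ℝ) + 3) / ((j : ℝ) + 3) ^ 2) *
            ∑ ρ ∈ F with windowIndex ρ = j, (riemannZetaZeroOrder ρ : ℝ) := by
          rw [Finset.mul_sum]
          exact Finset.sum_congr rfl fun _ _ ↦ by ring
      _ ≤ (4 * Real.log ((j : ℝ) + 3) / ((j : ℝ) + 3) ^ 2) * (2 * C * Real.log ((j : ℝ) + 3)) :=
          mul_le_mul_of_nonneg_left hcount (div_nonneg (by positivity) (by positivity))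
      _ = 8 * C * (Real.log ((j : ℝ) + 3) ^ 2 / ((j : ℝ) + 3) ^ 2) := by ring
  calc ∑ j ∈ Finset.range M, ∑ ρ ∈ F with windowIndex ρ = j,
        (riemannZetaZeroOrder ρ : ℝ) * Real.log (|ρ.im| + 2) / (|ρ.im| + 2) ^ 2
      ≤ ∑ j ∈ Finset.range M, 8 * C * (Real.log ((j : ℝ) + 3) ^ 2 / ((j : ℝ) + 3) ^ 2) :=
        Finset.sum_le_sum hfiber
    _ = 8 * C * ∑ j ∈ Finset.range M, Real.log ((j : ℝ) + 3) ^ 2 / ((j : ℝ) + 3) ^ 2 := by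
        rw [Finset.mul_sum]
    _ ≤ 8 * C * T := by
        refine mul_le_mul_of_nonneg_left ?_ (by positivity)
        rw [hTdef]
        exact hT.sum_le_tsum (Finset.range M) fun j _ ↦ by positivity

/-- **Part 2: `∑_ρ m(ρ) log(|Im ρ| + 2)/‖s − ρ‖² < ∞`** over the non-trivial zeros, for every
`s : ℂ` (`zeroWindowCount_summable_base`, and `‖s − ρ‖ ≥ (|Im ρ| + 2)/4` for all but the finitely
many zeros with `‖ρ‖ < 2‖s‖ + 2`). [folklore] -/
theorem zeroWindowCount_summable_shift (s : ℂ) :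
    Summable fun ρ : ZetaZeros.riemannZetaNontrivialZeros ↦
      (riemannZetaZeroOrder (ρ : ℂ) : ℝ) * Real.log (|(ρ : ℂ).im| + 2) / ‖s - (ρ : ℂ)‖ ^ 2 := by
  have h0 := zeroWindowCount_summable_base
  refine Summable.of_norm_bounded_eventually (h0.mul_left 16) (Filter.eventually_cofinite.2 ?_)
  refine ((riemannZetaNontrivialZeros_finite_inter_ball 0 (2 * ‖s‖ + 2)).preimage
    Subtype.val_injective.injOn).subset fun ρ hρ ↦ ⟨ρ.2, ?_⟩
  rw [Metric.mem_ball, dist_zero_right]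
  by_contra hge
  apply hρ
  have hm : (0 : ℝ) ≤ riemannZetaZeroOrder (ρ : ℂ) :=
    riemannZetaZeroOrder_nonneg_of_zero (ZetaZeros.riemannZetaNontrivialZeros.zeta_eq_zero ρ.2)
  have hlog0 : 0 ≤ Real.log (|(ρ : ℂ).im| + 2) := Real.log_nonneg (by linarith [abs_nonneg (ρ : ℂ).im])
  have hρn : 2 * ‖s‖ + 2 ≤ ‖(ρ : ℂ)‖ := not_lt.1 hge
  have hd : (|(ρ : ℂ).im| + 2) / 4 ≤ ‖s - (ρ : ℂ)‖ := by
    have h1 := norm_sub_norm_le (ρ : ℂ) s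
    rw [norm_sub_rev] at h1
    have h2 := abs_im_le_norm (ρ : ℂ)
    linarith [norm_nonneg s]
  have hpos : 0 < (|(ρ : ℂ).im| + 2) / 4 := by positivity
  rw [Real.norm_of_nonneg (div_nonneg (mul_nonneg hm hlog0) (sq_nonneg _)),
    show 16 * ((riemannZetaZeroOrder (ρ : ℂ) : ℝ) * Real.log (|(ρ : ℂ).im| + 2) /
        (|(ρ : ℂ).im| + 2) ^ 2) =
      (riemannZetaZeroOrder (ρ : ℂ) : ℝ) * Real.log (|(ρ : ℂ).im| + 2) /
        ((|(ρ : ℂ).im| + 2) / 4) ^ 2 by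
      field_simp
      ring]
  exact div_le_div_of_nonneg_left (mul_nonneg hm hlog0) (by positivity) (pow_le_pow_left₀ hpos.le hd 2)

/-- **Stub `stub_zeroWindowCount` (W6d): non-trivial zeros in unit windows, RH-free.**
(i) There is `C > 0` such that for every real `τ` and every finite set `F` of non-trivial zeros of
`ζ` with `|Im ρ − τ| ≤ 1/2`, `∑_{ρ ∈ F} m(ρ) ≤ C log(|τ| + 2)` (`m = riemannZetaZeroOrder`;
Jensen's inequality for `Re ρ ≥ 1/4` and the reflection `ρ ↦ 1 − ρ̄` for `Re ρ < 1/4`).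
(ii) For every `s : ℂ`, `∑_ρ m(ρ) log(|Im ρ| + 2)/‖s − ρ‖² < ∞` over all non-trivial zeros
(partial summation over unit windows with (i)). [cite: MontgomeryVaughan2007, Thm. 10.13] -/
theorem stub_zeroWindowCount :
    (∃ C : ℝ, 0 < C ∧ ∀ (τ : ℝ) (F : Finset ℂ),
      (∀ ρ ∈ F, ρ ∈ ZetaZeros.riemannZetaNontrivialZeros ∧ |ρ.im - τ| ≤ 1 / 2) →
        ∑ ρ ∈ F, (riemannZetaZeroOrder ρ : ℝ) ≤ C * Real.log (|τ| + 2)) ∧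
    (∀ s : ℂ, Summable fun ρ : ZetaZeros.riemannZetaNontrivialZeros =>
      (riemannZetaZeroOrder (ρ : ℂ) : ℝ) * Real.log (|(ρ : ℂ).im| + 2) / ‖s - (ρ : ℂ)‖ ^ 2) :=
  ⟨zeroWindowCount_exists_sum_le, zeroWindowCount_summable_shift⟩

end Summit.RiemannHypothesis.RiemannHypothesis.Theorems.GroundStatesConvergeToXi

end
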